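import Summits.QuantumAdvantage.QuantumAdvantage.Theorems.SosSandwichPseudoBoundedAAClassicalCornerLevelOnePath
import Literature.Computability.Complexity.DecisionTreeQueries
import HarnessLib

/-!
# Crux `PseudoBoundedAA` (stmt-QuantumAdvantage-15237, route SosSandwich) — the classical corner `R_T`:
# leaf averages with COORDINATE-WISE domination and `Cov([t acc], g) ≤ ¼ √(E_x Σ_{l ∈ t.queries x} (g(x^{l→1}) − g(x^{l→0}))²)`
# (per-tree part of the path-sensitivity law)

Support file for the rank-2 crux PB-AA (`Theses/SosSandwich.lean`, item stmt-QuantumAdvantage-15237), classical corner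
`R_T ⊆ K_T` (acceptance probabilities `p = Σ_k w_k·[t_k accepts]` of randomized classical query algorithms).  The tree holds on
`R_T` the laws `16·Var[p]² ≤ D̄²·maxⱼ Infⱼ[p]` (`ClassicalCorner`), `16·Var² ≤ D̄·E_x maxⱼ (p(x) − p(xʲ))²`
(`ClassicalCornerQuadratic`) and its expected-cost form (`ClassicalCornerQuadraticCost`); whether `16·Var² ≤ C·T·maxⱼ Infⱼ`
(exponent ONE in `T` with the maximum OUTSIDE the expectation) holds on `R_T` is the open calibration question, settled for the
nonadaptive sub-corner and for the level-one part of the variance in the companion files `…ClassicalCornerNonadaptive`,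
`…ClassicalCornerLevelOne`.

This file and its sequel `…ClassicalCornerPathSensitivity` prove the sharpest law of this family, charging the squared increments of `p` ONLY at the coordinates the tree
actually reads on each input (`DecisionTree.queries`, `Literature/Computability/Complexity/DecisionTreeQueries`):

  `16 · Var[p]² ≤ Σ_k w_k · E_x Σ_{l ∈ t_k.queries x} (p(x^{l→1}) − p(x^{l→0}))²`   (`sixteen_variance_sq_le_pathSensitivity`),

equality shape for the uniform mixture of the `N` dictators.  Since `Σ_{l ∈ queries x} (…)² ≤ cost_{t}(x) · maxⱼ (…)²`
(`pathSensitivity_le_cost_mul`) it refines the earlier laws, and it reduces the `(2,1)` question on `R_T` to ONE inequality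
(`sixteen_variance_sq_le_of_pathSensitivity_le`): is the sensitivity that `p ∈ R_T` carries along the query path of a
depth-`T` tree of its own mixture at most `C · T · maxⱼ Infⱼ[p]`?

* `exists_leafAvg_path` — leaf averages of `g` along a tree under a partial assignment (`∃`-form) with the leaf-martingale
  bound under COORDINATE-WISE domination: `Σₓ (A − ḡ)² ≤ ¼ Σₓ Σ_{l ∈ t.queries(x^ρ)} (g(x^{l→1}) − g(x^{l→0}))²`;
* `cov_le_sqrt_pathSensitivity`, `cov_le_sqrt_pathSensitivity_self` — `Cov([t acc], g) ≤ ¼ √(E_x Σ_{l ∈ t.queries x} (…)²)`;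
* `pathSensitivity_le_cost_mul` — `Σ_{l ∈ t.queries x} (…)² ≤ cost_t(x) · m x` (refinement of the cost law);
* the mixture statements (`sixteen_variance_sq_le_weighted`, `…_pathSensitivity`, `…_of_pathSensitivity_le`) are in the sequel.

Honest label: a sharpened form (same inductive proof, finer bookkeeping) of the tree's quadratic OSSS law on the classical
corner of an open conjecture; no stub, crux or summit is closed.
Sources: R. O'Donnell, M. Saks, O. Schramm, R. Servedio, *Every decision tree has an influential variable*, FOCS 2005, Thm 3.2;
H. Lee, *Decision trees and influence: an inductive proof of the OSSS inequality*, Theory of Computing 6 (2010) 81–84;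
S. Aaronson, A. Ambainis, *The need for structure in quantum speedups*, arXiv:0911.0996, Conj. 6 / Thm 8.
-/

set_option linter.dupNamespace false

noncomputable section

namespace Summit.QuantumAdvantage.QuantumAdvantage.Theorems.SosSandwich

open Finset Function
open Literature.Computability.Complexity Literature.Computability.QuantumComplexity

namespace ClassicalCornerPathSensitivity

variable {N : ℕ}

/-- `Σ_{l ∈ insert i Q} f l = f i + Σ_{l ∈ Q.erase i} f l`. [folklore] -/
theorem sum_insert_eq_add_sum_erase (Q : Finset (Fin N)) (i : Fin N) (f : Fin N → ℝ) :
    ∑ l ∈ insert i Q, f l = f i + ∑ l ∈ Q.erase i, f l := by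
  classical
  have h : insert i Q = insert i (Q.erase i) := by
    ext l
    simp only [Finset.mem_insert, Finset.mem_erase]
    tauto
  rw [h, Finset.sum_insert (Finset.notMem_erase i Q)]

/-- **Leaf averages with the PATH-SENSITIVITY bound.**  Let the tree `t` be run on the input overridden by the partial
assignment `ρ` and let `g` be any real function on the cube.  There is `A` (the average of `g` over the leaf subcube
reached by `x`) with: (i) `Σₓ A = Σₓ g`; (ii) `Σₓ F·g = Σₓ F·A` for the `0/1` output `F` of `t`; (iii) `A` ignores every
coordinate that `ρ` assigns and `g` ignores; (iv) the leaf-martingale bound with COORDINATE-WISE domination: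
`Σₓ (A x − ḡ)² ≤ ¼ · Σₓ Σ_{l ∈ t.queries(x^ρ)} (g(x^{l→1}) − g(x^{l→0}))²` — the squared increments of `g` are charged only
at the coordinates the tree actually reads on `x` (compare `ClassicalCornerQuadratic.exists_leafAvg`: `¼ · depth · Σₓ m x` for
a uniform dominating `m`).  Induction on `t`; at a fresh root `i` the variance of `A` splits into the two section variances plus
`2^N (ḡ₁ − ḡ₀)²/4 ≤ ¼ Σₓ (g(x^{i→1}) − g(x^{i→0}))²`, and the root `i` is read on every input.
[cite: OdonnellEtAl2005, Thm 3.2 (L¹ form)] [cite: Lee2010, Thm 1 (inductive proof)] -/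
theorem exists_leafAvg_path (t : DecisionTree N) :
    ∀ (ρ : Fin N → Option Bool) (g : (Fin N → Bool) → ℝ),
      ∃ A : (Fin N → Bool) → ℝ,
        (∑ x, A x = ∑ x, g x) ∧
        (∀ F : (Fin N → Bool) → ℝ, (∀ x, F x = if t.eval (fun k => (ρ k).getD (x k)) = true then (1 : ℝ) else 0) →
          ∑ x, F x * g x = ∑ x, F x * A x) ∧
        (∀ i : Fin N, ρ i ≠ none → (∀ y c, g (update y i c) = g y) → ∀ y c, A (update y i c) = A y) ∧
        ∑ x, (A x - (∑ y, g y) / (2 : ℝ) ^ N) ^ 2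
          ≤ (1 / 4) * ∑ x : Fin N → Bool, ∑ l ∈ t.queries (fun k => (ρ k).getD (x k)),
              (g (update x l true) - g (update x l false)) ^ 2 := by
  induction t with
  | leaf c =>
    intro ρ g
    refine ⟨fun _ => (∑ y, g y) / (2 : ℝ) ^ N, ?_, ?_, ?_, ?_⟩
    · rw [Finset.sum_const, Finset.card_univ, BooleanCorner.card_cube_nat, nsmul_eq_mul]
      push_cast
      field_simp
    · intro F hF
      have hc : ∀ x : Fin N → Bool, F x = (if c = true then (1 : ℝ) else 0) := fun x => by
        rw [hF x]; simp [DecisionTree.eval]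
      simp only [hc, ← Finset.mul_sum]
      rw [Finset.sum_const, Finset.card_univ, BooleanCorner.card_cube_nat, nsmul_eq_mul]
      push_cast
      field_simp
    · intro i _ _ y c'; rfl
    · simp
  | query i t₀ t₁ ih₀ ih₁ =>
    intro ρ g
    have h2 : (2 : ℝ) ^ N ≠ 0 := by positivity
    have h2N : (0 : ℝ) < (2 : ℝ) ^ N := by positivity
    rcases hρ : ρ i with _ | b
    · /- fresh query: split along `x i` -/
      obtain ⟨g₀, hg₀⟩ : ∃ g₀ : (Fin N → Bool) → ℝ, ∀ x, g₀ x = g (update x i false) := ⟨_, fun _ => rfl⟩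
      obtain ⟨g₁, hg₁⟩ : ∃ g₁ : (Fin N → Bool) → ℝ, ∀ x, g₁ x = g (update x i true) := ⟨_, fun _ => rfl⟩
      obtain ⟨A₀, hA₀s, hA₀F, hA₀u, hA₀v⟩ := ih₀ (update ρ i (some false)) g₀
      obtain ⟨A₁, hA₁s, hA₁F, hA₁u, hA₁v⟩ := ih₁ (update ρ i (some true)) g₁
      have hg₀u : ∀ x c, g₀ (update x i c) = g₀ x := fun x c => by rw [hg₀, hg₀, update_idem]
      have hg₁u : ∀ x c, g₁ (update x i c) = g₁ x := fun x c => by rw [hg₁, hg₁, update_idem]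
      have hρ₀i : update ρ i (some false) i ≠ none := by simp
      have hρ₁i : update ρ i (some true) i ≠ none := by simp
      have hA₀i : ∀ x c, A₀ (update x i c) = A₀ x := hA₀u i hρ₀i hg₀u
      have hA₁i : ∀ x c, A₁ (update x i c) = A₁ x := hA₁u i hρ₁i hg₁u
      have hxi : ∀ x : Fin N → Bool, (ρ i).getD (x i) = x i := fun x => by simp [hρ]
      refine ⟨fun x => if x i = true then A₁ x else A₀ x, ?_, ?_, ?_, ?_⟩
      · -- (i) the total
        rw [BooleanCorner.sum_ite_update i _ _ hA₁i hA₀i, hA₁s, hA₀s, BooleanCorner.sum_eq_half_sum_update i g]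
        congr 1
        congr 1
        · exact Finset.sum_congr rfl fun x _ => hg₁ x
        · exact Finset.sum_congr rfl fun x _ => hg₀ x
      · -- (ii) `F` cannot tell `g` from `A`
        intro F hF
        obtain ⟨F₀, hF₀⟩ : ∃ F₀ : (Fin N → Bool) → ℝ, ∀ x,
            F₀ x = if t₀.eval (fun k => (update ρ i (some false) k).getD (x k)) = true then (1 : ℝ) else 0 :=
          ⟨_, fun _ => rfl⟩
        obtain ⟨F₁, hF₁⟩ : ∃ F₁ : (Fin N → Bool) → ℝ, ∀ x,
            F₁ x = if t₁.eval (fun k => (update ρ i (some true) k).getD (x k)) = true then (1 : ℝ) else 0 :=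
          ⟨_, fun _ => rfl⟩
        have hF₀u : ∀ x c, F₀ (update x i c) = F₀ x := fun x c => by
          rw [hF₀, hF₀, ClassicalCornerLevelOne.ovr_update_eq _ i hρ₀i x c]
        have hF₁u : ∀ x c, F₁ (update x i c) = F₁ x := fun x c => by
          rw [hF₁, hF₁, ClassicalCornerLevelOne.ovr_update_eq _ i hρ₁i x c]
        have hFx : ∀ x : Fin N → Bool, F x = if x i = true then F₁ x else F₀ x := by
          intro x
          rw [hF x, DecisionTree.eval_query, hxi x]
          rcases Bool.eq_false_or_eq_true (x i) with hx | hx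
          · rw [hx, if_pos rfl, if_pos rfl, hF₁ x, ClassicalCornerLevelOne.ovr_eq_ovr_update ρ i hρ x true hx]
          · rw [hx, if_neg Bool.false_ne_true, if_neg Bool.false_ne_true, hF₀ x,
              ClassicalCornerLevelOne.ovr_eq_ovr_update ρ i hρ x false hx]
        have hgs : ∀ x : Fin N → Bool, g x = if x i = true then g₁ x else g₀ x := by
          intro x
          rcases Bool.eq_false_or_eq_true (x i) with hx | hx
          · rw [hx, if_pos rfl, hg₁, ← hx, update_eq_self]
          · rw [hx, if_neg Bool.false_ne_true, hg₀, ← hx, update_eq_self]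
        have hSfg : ∑ x, F x * g x = ((∑ x, F₁ x * g₁ x) + ∑ x, F₀ x * g₀ x) / 2 := by
          have : ∀ x, F x * g x = if x i = true then F₁ x * g₁ x else F₀ x * g₀ x := by
            intro x; rw [hFx x, hgs x]; split_ifs <;> rfl
          rw [Finset.sum_congr rfl fun x _ => this x]
          exact BooleanCorner.sum_ite_update i _ _ (fun x c => by rw [hF₁u, hg₁u]) (fun x c => by rw [hF₀u, hg₀u])
        have hSfA : ∑ x, F x * (if x i = true then A₁ x else A₀ x)
            = ((∑ x, F₁ x * A₁ x) + ∑ x, F₀ x * A₀ x) / 2 := by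
          have : ∀ x, F x * (if x i = true then A₁ x else A₀ x)
              = if x i = true then F₁ x * A₁ x else F₀ x * A₀ x := by
            intro x; rw [hFx x]; split_ifs <;> rfl
          rw [Finset.sum_congr rfl fun x _ => this x]
          exact BooleanCorner.sum_ite_update i _ _ (fun x c => by rw [hF₁u, hA₁i]) (fun x c => by rw [hF₀u, hA₀i])
        rw [hSfg, hSfA, hA₁F F₁ hF₁, hA₀F F₀ hF₀]
      · -- (iii) invariance under an assigned coordinate `i' ≠ i`
        intro i' hρi' hgi' y c
        have hii : i ≠ i' := by rintro rfl; exact hρi' hρ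
        have hy : (update y i' c) i = y i := update_of_ne hii _ _
        have hρ' : ∀ b : Bool, (update ρ i (some b)) i' ≠ none := by
          intro b; rw [update_of_ne (Ne.symm hii)]; exact hρi'
        have hg₁' : ∀ y c', g₁ (update y i' c') = g₁ y := by
          intro y c'; rw [hg₁, hg₁, update_comm (Ne.symm hii), hgi']
        have hg₀' : ∀ y c', g₀ (update y i' c') = g₀ y := by
          intro y c'; rw [hg₀, hg₀, update_comm (Ne.symm hii), hgi']
        simp only [hy]
        split_ifs
        · exact hA₁u i' (hρ' true) hg₁' y c
        · exact hA₀u i' (hρ' false) hg₀' y c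
      · -- (iv) the leaf-martingale bound with coordinate-wise domination
        set μ₀ := (∑ y, g₀ y) / (2 : ℝ) ^ N with hμ₀
        set μ₁ := (∑ y, g₁ y) / (2 : ℝ) ^ N with hμ₁
        set gbar := (∑ y, g y) / (2 : ℝ) ^ N with hgbar
        have hgsplit : ∑ y, g y = ((∑ y, g₁ y) + ∑ y, g₀ y) / 2 := by
          rw [BooleanCorner.sum_eq_half_sum_update i g]
          congr 1
          congr 1
          · exact Finset.sum_congr rfl fun x _ => (hg₁ x).symm
          · exact Finset.sum_congr rfl fun x _ => (hg₀ x).symm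
        have hgbar' : gbar = (μ₁ + μ₀) / 2 := by
          rw [hgbar, hμ₁, hμ₀, hgsplit]; field_simp
        have hL : ∑ x, ((if x i = true then A₁ x else A₀ x) - gbar) ^ 2
            = ((∑ x, (A₁ x - gbar) ^ 2) + ∑ x, (A₀ x - gbar) ^ 2) / 2 := by
          have : ∀ x : Fin N → Bool, ((if x i = true then A₁ x else A₀ x) - gbar) ^ 2
              = if x i = true then (A₁ x - gbar) ^ 2 else (A₀ x - gbar) ^ 2 := by
            intro x; split_ifs <;> rfl
          rw [Finset.sum_congr rfl fun x _ => this x]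
          exact BooleanCorner.sum_ite_update i _ _ (fun x c => by rw [hA₁i]) (fun x c => by rw [hA₀i])
        have hsA₁ : ∑ x, A₁ x = (2 : ℝ) ^ N * μ₁ := by rw [hA₁s, hμ₁]; field_simp
        have hsA₀ : ∑ x, A₀ x = (2 : ℝ) ^ N * μ₀ := by rw [hA₀s, hμ₀]; field_simp
        have hc₁ := ClassicalCornerQuadratic.sum_sq_sub_eq_sum_sq_sub_add A₁ μ₁ gbar hsA₁
        have hc₀ := ClassicalCornerQuadratic.sum_sq_sub_eq_sum_sq_sub_add A₀ μ₀ gbar hsA₀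
        -- the root increment: `2^N (μ₁ − μ₀)² ≤ Σₓ (g(x^{i→1}) − g(x^{i→0}))²`
        have hroot : (2 : ℝ) ^ N * (μ₁ - μ₀) ^ 2 ≤ ∑ x, (g (update x i true) - g (update x i false)) ^ 2 := by
          have hdiff : μ₁ - μ₀ = (∑ x, (g (update x i true) - g (update x i false))) / (2 : ℝ) ^ N := by
            rw [hμ₁, hμ₀, Finset.sum_sub_distrib]
            rw [Finset.sum_congr rfl fun x _ => hg₁ x, Finset.sum_congr rfl fun x _ => hg₀ x]
            field_simp
          have hcs := ClassicalCornerQuadratic.sq_sum_le_card_mul_sum_sq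
            (fun x => g (update x i true) - g (update x i false))
          rw [hdiff, div_pow]
          calc (2 : ℝ) ^ N * ((∑ x, (g (update x i true) - g (update x i false))) ^ 2 / ((2 : ℝ) ^ N) ^ 2)
              = (∑ x, (g (update x i true) - g (update x i false))) ^ 2 / (2 : ℝ) ^ N := by field_simp
            _ ≤ ((2 : ℝ) ^ N * ∑ x, (g (update x i true) - g (update x i false)) ^ 2) / (2 : ℝ) ^ N :=
                div_le_div_of_nonneg_right hcs h2N.le
            _ = ∑ x, (g (update x i true) - g (update x i false)) ^ 2 := by field_simp
        -- the path sums of the sections, re-expressed on the two halves of the cube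
        have hsec : ∀ (b : Bool) (gb : (Fin N → Bool) → ℝ), (∀ x, gb x = g (update x i b)) →
            ∀ (tb : DecisionTree N) (x : Fin N → Bool),
              ∑ l ∈ tb.queries (fun k => (update ρ i (some b) k).getD (x k)),
                  (gb (update x l true) - gb (update x l false)) ^ 2
                = ∑ l ∈ (tb.queries (fun k => (update ρ i (some b) k).getD ((update x i b) k))).erase i,
                    (g (update (update x i b) l true) - g (update (update x i b) l false)) ^ 2 := by
          intro b gb hgb tb x
          have hρbi : update ρ i (some b) i ≠ none := by simp
          rw [ClassicalCornerLevelOne.ovr_update_eq _ i hρbi x b]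
          have hzero : (gb (update x i true) - gb (update x i false)) ^ 2 = 0 := by
            rw [hgb, hgb, update_idem, update_idem, sub_self]
            ring
          rw [← Finset.sum_erase (f := fun l => (gb (update x l true) - gb (update x l false)) ^ 2) _ hzero]
          refine Finset.sum_congr rfl fun l hl => ?_
          have hli : l ≠ i := Finset.ne_of_mem_erase hl
          rw [hgb, hgb, update_comm hli, update_comm hli]
        -- the root is read on every input: the path sum of `t` splits into the root term and the branch sums
        have hMx : ∀ x : Fin N → Bool,
            ∑ l ∈ (DecisionTree.query i t₀ t₁).queries (fun k => (ρ k).getD (x k)),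
                (g (update x l true) - g (update x l false)) ^ 2
              = (g (update x i true) - g (update x i false)) ^ 2 +
                (if x i = true then
                  ∑ l ∈ (t₁.queries (fun k => (update ρ i (some true) k).getD (x k))).erase i,
                    (g (update x l true) - g (update x l false)) ^ 2
                 else
                  ∑ l ∈ (t₀.queries (fun k => (update ρ i (some false) k).getD (x k))).erase i,
                    (g (update x l true) - g (update x l false)) ^ 2) := by
          intro x
          rw [DecisionTree.queries_query, hxi x]
          rcases Bool.eq_false_or_eq_true (x i) with hx | hx
          · rw [hx, if_pos rfl, if_pos rfl, ClassicalCornerLevelOne.ovr_eq_ovr_update ρ i hρ x true hx,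
              sum_insert_eq_add_sum_erase]
          · rw [hx, if_neg Bool.false_ne_true, if_neg Bool.false_ne_true,
              ClassicalCornerLevelOne.ovr_eq_ovr_update ρ i hρ x false hx, sum_insert_eq_add_sum_erase]
        have hM : ∑ x : Fin N → Bool, ∑ l ∈ (DecisionTree.query i t₀ t₁).queries (fun k => (ρ k).getD (x k)),
              (g (update x l true) - g (update x l false)) ^ 2
            = (∑ x : Fin N → Bool, (g (update x i true) - g (update x i false)) ^ 2) +
              ((∑ x : Fin N → Bool, ∑ l ∈ t₁.queries (fun k => (update ρ i (some true) k).getD (x k)),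
                  (g₁ (update x l true) - g₁ (update x l false)) ^ 2) +
               ∑ x : Fin N → Bool, ∑ l ∈ t₀.queries (fun k => (update ρ i (some false) k).getD (x k)),
                  (g₀ (update x l true) - g₀ (update x l false)) ^ 2) / 2 := by
          rw [Finset.sum_congr rfl fun x _ => hMx x, Finset.sum_add_distrib]
          congr 1
          rw [BooleanCorner.sum_eq_half_sum_update i (fun x => if x i = true then
                  ∑ l ∈ (t₁.queries (fun k => (update ρ i (some true) k).getD (x k))).erase i,
                    (g (update x l true) - g (update x l false)) ^ 2
                 else
                  ∑ l ∈ (t₀.queries (fun k => (update ρ i (some false) k).getD (x k))).erase i,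
                    (g (update x l true) - g (update x l false)) ^ 2)]
          congr 1
          congr 1
          · refine Finset.sum_congr rfl fun x _ => ?_
            simp only [update_self, if_true]
            exact (hsec true g₁ hg₁ t₁ x).symm
          · refine Finset.sum_congr rfl fun x _ => ?_
            simp only [update_self, Bool.false_eq_true, if_false]
            exact (hsec false g₀ hg₀ t₀ x).symm
        rw [hL, hc₁, hc₀, hgbar', hM]
        have hmid : (μ₁ - (μ₁ + μ₀) / 2) ^ 2 + (μ₀ - (μ₁ + μ₀) / 2) ^ 2 = (μ₁ - μ₀) ^ 2 / 2 := by ring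
        nlinarith [hA₁v, hA₀v, hroot, hmid]
    · /- the root variable is already assigned by `ρ`: the tree behaves as the `b`-subtree, and reads a superset -/
      have hxi : ∀ x : Fin N → Bool, (ρ i).getD (x i) = b := fun x => by simp [hρ]
      have hmono : ∀ (tb : DecisionTree N) (x : Fin N → Bool),
          (DecisionTree.query i t₀ t₁).queries (fun k => (ρ k).getD (x k))
              = insert i (if b = true then t₁.queries (fun k => (ρ k).getD (x k))
                          else t₀.queries (fun k => (ρ k).getD (x k))) →
          (tb = if b = true then t₁ else t₀) →
          ∑ l ∈ tb.queries (fun k => (ρ k).getD (x k)), (g (update x l true) - g (update x l false)) ^ 2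
            ≤ ∑ l ∈ (DecisionTree.query i t₀ t₁).queries (fun k => (ρ k).getD (x k)),
                (g (update x l true) - g (update x l false)) ^ 2 := by
        intro tb x hq htb
        rw [hq]
        refine Finset.sum_le_sum_of_subset_of_nonneg ?_ (fun l _ _ => sq_nonneg _)
        rw [htb]
        split_ifs <;> exact Finset.subset_insert _ _
      have hq : ∀ x : Fin N → Bool, (DecisionTree.query i t₀ t₁).queries (fun k => (ρ k).getD (x k))
          = insert i (if b = true then t₁.queries (fun k => (ρ k).getD (x k))
                      else t₀.queries (fun k => (ρ k).getD (x k))) := by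
        intro x; rw [DecisionTree.queries_query, hxi x]
      cases b with
      | false =>
        obtain ⟨A, h1, h2, h3, h4⟩ := ih₀ ρ g
        refine ⟨A, h1, fun F hF => h2 F (fun x => by rw [hF x, DecisionTree.eval_query, hxi x]; rfl), h3,
          h4.trans ?_⟩
        refine mul_le_mul_of_nonneg_left (Finset.sum_le_sum fun x _ => hmono t₀ x (hq x) (by simp)) (by norm_num)
      | true =>
        obtain ⟨A, h1, h2, h3, h4⟩ := ih₁ ρ g
        refine ⟨A, h1, fun F hF => h2 F (fun x => by rw [hF x, DecisionTree.eval_query, hxi x]; rfl), h3,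
          h4.trans ?_⟩
        refine mul_le_mul_of_nonneg_left (Finset.sum_le_sum fun x _ => hmono t₁ x (hq x) (by simp)) (by norm_num)

/-! ### One tree: covariance against the path sensitivity -/

/-- **Quadratic OSSS for one tree, path-sensitivity form.** With `F` the `0/1` output of `t` (run under `ρ`) and any real `g`:
`2^N Σ F g − (Σ F)(Σ g) ≤ (2^N/4) · √(2^N · Σₓ Σ_{l ∈ t.queries(x^ρ)} (g(x^{l→1}) − g(x^{l→0}))²)`, i.e.
`Cov(F, g) ≤ ¼ √(E_x Σ_{l queried on x} (g(x^{l→1}) − g(x^{l→0}))²)` — from `exists_leafAvg_path` exactly as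
`ClassicalCornerQuadratic.cov_le_sqrt_depth` follows from `exists_leafAvg`. [cite: OdonnellEtAl2005, Thm 3.2 (L¹ form)] -/
theorem cov_le_sqrt_pathSensitivity (t : DecisionTree N) (ρ : Fin N → Option Bool) (F g : (Fin N → Bool) → ℝ)
    (hF : ∀ x, F x = if t.eval (fun k => (ρ k).getD (x k)) = true then (1 : ℝ) else 0) :
    (2 : ℝ) ^ N * (∑ x, F x * g x) - (∑ x, F x) * (∑ x, g x)
      ≤ (2 : ℝ) ^ N / 4 * Real.sqrt ((2 : ℝ) ^ N * ∑ x : Fin N → Bool,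
          ∑ l ∈ t.queries (fun k => (ρ k).getD (x k)), (g (update x l true) - g (update x l false)) ^ 2) := by
  obtain ⟨A, hAs, hAF, -, hAv⟩ := exists_leafAvg_path t ρ g
  have h2 : (2 : ℝ) ^ N ≠ 0 := by positivity
  have h2N : (0 : ℝ) ≤ (2 : ℝ) ^ N := by positivity
  set P := ∑ x : Fin N → Bool, ∑ l ∈ t.queries (fun k => (ρ k).getD (x k)),
      (g (update x l true) - g (update x l false)) ^ 2 with hP
  set gbar := (∑ y, g y) / (2 : ℝ) ^ N with hgbar
  have hF12 : ∀ x, |F x - 1 / 2| = 1 / 2 := by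
    intro x; rw [hF x]; split_ifs <;> norm_num
  have hlhs : (2 : ℝ) ^ N * (∑ x, F x * g x) - (∑ x, F x) * (∑ x, g x)
      = (2 : ℝ) ^ N * ∑ x, F x * (A x - gbar) := by
    have hg : ∑ x, g x = (2 : ℝ) ^ N * gbar := by rw [hgbar]; field_simp
    rw [hAF F hF, hg]
    have : ∑ x, F x * (A x - gbar) = (∑ x, F x * A x) - gbar * ∑ x, F x := by
      rw [Finset.mul_sum, ← Finset.sum_sub_distrib]
      exact Finset.sum_congr rfl fun x _ => by ring
    rw [this]; ring
  have hzero : ∑ x, (A x - gbar) = 0 := by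
    rw [Finset.sum_sub_distrib, hAs, Finset.sum_const, Finset.card_univ, BooleanCorner.card_cube_nat,
      nsmul_eq_mul, hgbar]
    push_cast
    field_simp
    ring
  set L := ∑ x, |A x - gbar| with hL
  have hkey : ∑ x, F x * (A x - gbar) ≤ (1 / 2) * L := by
    have h1 : ∑ x, F x * (A x - gbar) = ∑ x, (F x - 1 / 2) * (A x - gbar) := by
      have : ∑ x, (F x - 1 / 2) * (A x - gbar) = (∑ x, F x * (A x - gbar)) - (1 / 2) * ∑ x, (A x - gbar) := by
        rw [Finset.mul_sum, ← Finset.sum_sub_distrib]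
        exact Finset.sum_congr rfl fun x _ => by ring
      rw [this, hzero]; ring
    rw [h1, hL, Finset.mul_sum]
    refine Finset.sum_le_sum fun x _ => ?_
    calc (F x - 1 / 2) * (A x - gbar) ≤ |(F x - 1 / 2) * (A x - gbar)| := le_abs_self _
      _ = |F x - 1 / 2| * |A x - gbar| := abs_mul _ _
      _ = 1 / 2 * |A x - gbar| := by rw [hF12 x]
  have hL2 : L ^ 2 ≤ (2 : ℝ) ^ N * ∑ x, (A x - gbar) ^ 2 := by
    have h := ClassicalCornerQuadratic.sq_sum_le_card_mul_sum_sq (fun x => |A x - gbar|)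
    simp only [sq_abs] at h
    exact h
  have h2L : 2 * L ≤ Real.sqrt ((2 : ℝ) ^ N * P) := by
    apply Real.le_sqrt_of_sq_le
    have : (2 : ℝ) ^ N * ∑ x, (A x - gbar) ^ 2 ≤ (2 : ℝ) ^ N * ((1 / 4) * P) :=
      mul_le_mul_of_nonneg_left hAv h2N
    nlinarith [hL2, this]
  rw [hlhs]
  calc (2 : ℝ) ^ N * ∑ x, F x * (A x - gbar) ≤ (2 : ℝ) ^ N * ((1 / 2) * L) := mul_le_mul_of_nonneg_left hkey h2N
    _ = (2 : ℝ) ^ N / 4 * (2 * L) := by ring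
    _ ≤ (2 : ℝ) ^ N / 4 * Real.sqrt ((2 : ℝ) ^ N * P) := mul_le_mul_of_nonneg_left h2L (by positivity)

/-- The same for a tree run on the input itself (`ρ = ∅`). [cite: OdonnellEtAl2005, Thm 3.2 (L¹ form)] -/
theorem cov_le_sqrt_pathSensitivity_self (t : DecisionTree N) (F g : (Fin N → Bool) → ℝ)
    (hF : ∀ x, F x = if t.eval x = true then (1 : ℝ) else 0) :
    (2 : ℝ) ^ N * (∑ x, F x * g x) - (∑ x, F x) * (∑ x, g x)
      ≤ (2 : ℝ) ^ N / 4 * Real.sqrt ((2 : ℝ) ^ N * ∑ x : Fin N → Bool,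
          ∑ l ∈ t.queries x, (g (update x l true) - g (update x l false)) ^ 2) :=
  cov_le_sqrt_pathSensitivity t (fun _ => none) F g fun x => hF x

/-- **The path-sensitivity law refines the depth law.** For every tree and input, the path sensitivity is at most
`cost · maxⱼ` of the squared increments: if `(p(x^{j→1}) − p(x^{j→0}))² ≤ m x` for all `j`, then
`Σ_{l ∈ t.queries x} (p(x^{l→1}) − p(x^{l→0}))² ≤ cost_t(x) · m x ≤ depth(t) · m x`. [folklore] -/
theorem pathSensitivity_le_cost_mul (t : DecisionTree N) (g m : (Fin N → Bool) → ℝ) (x : Fin N → Bool)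
    (hm0 : 0 ≤ m x) (hm : ∀ j : Fin N, (g (update x j true) - g (update x j false)) ^ 2 ≤ m x) :
    ∑ l ∈ t.queries x, (g (update x l true) - g (update x l false)) ^ 2 ≤ (t.cost x : ℝ) * m x := by
  calc ∑ l ∈ t.queries x, (g (update x l true) - g (update x l false)) ^ 2
      ≤ ∑ _l ∈ t.queries x, m x := Finset.sum_le_sum fun l _ => hm l
    _ = ((t.queries x).card : ℝ) * m x := by rw [Finset.sum_const, nsmul_eq_mul]
    _ ≤ (t.cost x : ℝ) * m x :=
        mul_le_mul_of_nonneg_right (by exact_mod_cast DecisionTree.card_queries_le_cost t x) hm0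

end ClassicalCornerPathSensitivity

end Summit.QuantumAdvantage.QuantumAdvantage.Theorems.SosSandwich

end
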